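import Summits.KontsevichZagierPeriods.KontsevichZagierPeriods.Theorems.RootDecompRationalCubeDichotomyEtaleOuterGreen

/-!
# Route RootDecompRationalCubeDichotomy — items 29429 `PiRationalisationEtale` / 29431 `PiRationalisationGlue` PROVED, part 5/8: S2 `innerResidueE_holds` (weighted residue form + parametrised Green + explicit pole integrals) and the glue `greenReductionE_of` / `greenReductionE_holds` (`RootDecompRationalCubeDichotomyEtaleInnerResidue`)

Theorems-split (≤ 400 lines each, sequential imports) of the decomp-kz lens-2 gen-5 file
`run/shared/lean/pub/decomp-kz/decomp-kz-lens-2/g5/PiRationalisationEtale.lean` (sha256 204f4992…, 2557 lines; lens farm rc 0 / 0 sorry /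
std axioms; critic decomp-kz-crit-1 g2 CLEARED/CONFIRMED 2026-08-30T06:50:50Z «29429 + 29431 proved BY NAME»), landed by the census seat
decomp-kz-census-1 g6 with the 86 verbatim copies of already-landed declarations REMOVED in favour of `import`/`open` of the landed
`Rung27842.ReIm` / `Rung27842.SimpleBranch` / `Rung24903` chain (`ratCubeSet`, `piIter_mem_sup`, `RatBoxSet`, `BoxRescale`, `boxRescale_holds`,
the Re–Im polynomial calculus, the Green assembly kit, the S3/S1 lemmas), so that only the NEW weighted (étale) content is declared here.
The rung: for WEIGHTED simple-branch (standard-étale) data `[Π[loᵢ,hiᵢ], A(x,h x)/B(x,h x)]` (`F(x,h) = 0`, `∂_w F(x,h) ≠ 0`, `B(x,h) ≠ 0` on the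
closed box, `F A B ∈ ℚ[x,w]`, `h` ℚ-Nash near the box) `[π]^K·[s] ∈ relations ⊔ ⟨rational closed-cube sector⟩` for every `K ≥ 1` — the gen-4
argument-principle chain with the contour form `ω = A·F_w/(B·F) dw`, whose residue at the simple real root is `A/B = s.integrand`.
[Kontsevich–Zagier 2001 §1.2; argument principle] Standard axioms, 0 sorry.
-/

noncomputable section

set_option linter.dupNamespace false

namespace Summit.KontsevichZagierPeriods.RootDecompRationalCubeDichotomy.RungEtale.Etale

open MeasureTheory Set MvPolynomial
open Literature.NumberTheory.Transcendental Literature.NumberTheory.Transcendental.KZ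
open Literature.ModelTheory.ExponentialFields (IsSemialgebraic analyticOnNhd_aeval continuous_aeval_real)
open Summit.KontsevichZagierPeriods.KontsevichZagierPeriods.Theses.RootDecompRationalCubeDichotomy
open Summit.KontsevichZagierPeriods.RootDecompRationalCubeDichotomy.Rung24903 (of_sub_of_mem_relations_of_fibreMap)
open Summit.KontsevichZagierPeriods.RootDecompRationalCubeDichotomy.Rung27842
open Summit.KontsevichZagierPeriods.RootDecompRationalCubeDichotomy.Rung27842.RootIso
open Summit.KontsevichZagierPeriods.RootDecompRationalCubeDichotomy.Rung27842.SimpleBranch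
open Summit.KontsevichZagierPeriods.RootDecompRationalCubeDichotomy.Rung24903
  (piRep_mul_mem_sup_of_mem_closure piRep_mul_mem_sup piIter_mem_sup isSemialgebraic_cubeLit)

/-- **S2-E `InnerResidueE` HOLDS** (the weighted residue computation on the inner square). -/
theorem innerResidueE_holds : InnerResidueE := by
  intro n g U piece F A B lo hi a b c ε hU hsub hg han hlohi hdom hF hFz hB hint hiso
  have hab : (a:ℝ) < b := by exact_mod_cast hiso.1
  have hε : (0:ℝ) < ε := by exact_mod_cast hiso.2.1
  have hεc : (ε:ℝ) < c := by exact_mod_cast hiso.2.2.1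
  have hc : (0:ℝ) < c := hε.trans hεc
  have hmarg := hiso.2.2.2.1
  have hτc : IsCompact piece.domain := by rw [hdom]; exact isCompact_univ_pi fun _ => isCompact_Icc
  have hτs : IsSemialgebraic ℚ piece.domain := piece.isSemialgebraic_domain
  have hgτ : IsSemialgebraicFunOn ℚ piece.domain g := hg.mono hsub hτs
  have hgc : ContinuousOn g piece.domain := fun x hx => (han x (hsub hx)).continuousAt.continuousWithinAt
  -- the weight `φ = piece.integrand = A(x,g x)/B(x,g x)`
  have hcB : ∀ x ∈ piece.domain, piece.integrand x * aeval (Fin.snoc x (g x) : Fin (n + 1) → ℝ) B =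
      aeval (Fin.snoc x (g x) : Fin (n + 1) → ℝ) A := fun x hx => by
    rw [hint x hx, div_mul_cancel₀ _ (hB x hx)]
  have hφc : ContinuousOn piece.integrand piece.domain :=
    ((((continuous_aeval_real (k := ℚ) A).comp_continuousOn (continuousOn_graphMap hgc)).div
      ((continuous_aeval_real (k := ℚ) B).comp_continuousOn (continuousOn_graphMap hgc)) hB).congr
      fun x hx => hint x hx)
  -- bound functions on the base
  have hKε : IsSemialgebraicFunOn ℚ piece.domain (fun _ => (ε:ℝ)) := isSemialgebraicFunOn_ratCast hτs ε
  have hK0 : IsSemialgebraicFunOn ℚ piece.domain (fun _ => (0:ℝ)) :=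
    (isSemialgebraicFunOn_ratCast hτs 0).congr (fun _ _ => by simp)
  have hgm : IsSemialgebraicFunOn ℚ piece.domain (fun x => g x - ε) := IsSemialgebraicFunOn.sub_holds hgτ hKε
  have hgp : IsSemialgebraicFunOn ℚ piece.domain (fun x => g x + ε) := IsSemialgebraicFunOn.add_holds hgτ hKε
  have hgmc : ContinuousOn (fun x => g x - (ε:ℝ)) piece.domain := hgc.sub continuousOn_const
  have hgpc : ContinuousOn (fun x => g x + (ε:ℝ)) piece.domain := hgc.add continuousOn_const
  have cc : ∀ r : ℝ, ContinuousOn (fun _ : Fin n → ℝ => r) piece.domain := fun r => continuousOn_const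
  -- the two edge bases: `V = τ × [0, ε]` (vertical edges) and `T = {(x,u) : |u - g x| ≤ ε}` (top/bottom edges)
  have hV : IsSemialgebraic ℚ (KZlog.band piece.domain (fun _ => (0:ℝ)) (fun _ => (ε:ℝ))) :=
    KZlog.isSemialgebraic_band hK0 hKε
  have hT : IsSemialgebraic ℚ (KZlog.band piece.domain (fun x => g x - ε) (fun x => g x + ε)) :=
    KZlog.isSemialgebraic_band hgm hgp
  have hVc : IsCompact (KZlog.band piece.domain (fun _ => (0:ℝ)) (fun _ => (ε:ℝ))) := isCompact_band hτc (cc _) (cc _)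
  have hTc : IsCompact (KZlog.band piece.domain (fun x => g x - ε) (fun x => g x + ε)) := isCompact_band hτc hgmc hgpc
  have sub0 : ∀ {S : Set (Fin (n + 1) → ℝ)} {α β : (Fin n → ℝ) → ℝ}, S = KZlog.band piece.domain α β →
      S ⊆ {z | Fin.init z ∈ piece.domain} := fun h => h ▸ KZ.band_subset_setOf_init_mem
  have saK : ∀ {S : Set (Fin (n + 1) → ℝ)}, IsSemialgebraic ℚ S → ∀ q : ℚ, IsSemialgebraicFunOn ℚ S (fun _ => (q:ℝ)) :=
    fun hS q => isSemialgebraicFunOn_ratCast hS q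
  have saK0 : ∀ {S : Set (Fin (n + 1) → ℝ)}, IsSemialgebraic ℚ S → IsSemialgebraicFunOn ℚ S (fun _ => (0:ℝ)) :=
    fun hS => (isSemialgebraicFunOn_ratCast hS 0).congr (fun _ _ => by simp)
  have saG : ∀ {S : Set (Fin (n + 1) → ℝ)}, IsSemialgebraic ℚ S → S ⊆ {z | Fin.init z ∈ piece.domain} →
      IsSemialgebraicFunOn ℚ S (fun y => g (Fin.init y)) :=
    fun hS hSs => hgτ.comp_init_mono hS hSs
  have saGp : ∀ {S : Set (Fin (n + 1) → ℝ)}, IsSemialgebraic ℚ S → S ⊆ {z | Fin.init z ∈ piece.domain} →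
      IsSemialgebraicFunOn ℚ S (fun y => g (Fin.init y) + (ε:ℝ)) :=
    fun hS hSs => hgp.comp_init_mono hS hSs
  have saGm : ∀ {S : Set (Fin (n + 1) → ℝ)}, IsSemialgebraic ℚ S → S ⊆ {z | Fin.init z ∈ piece.domain} →
      IsSemialgebraicFunOn ℚ S (fun y => g (Fin.init y) - (ε:ℝ)) :=
    fun hS hSs => hgm.comp_init_mono hS hSs
  have coG : ∀ {S : Set (Fin (n + 1) → ℝ)}, S ⊆ {z | Fin.init z ∈ piece.domain} →
      ContinuousOn (fun y : Fin (n + 1) → ℝ => g (Fin.init y)) S :=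
    fun hSs => hgc.comp continuous_init'.continuousOn fun z hz => hSs hz
  have coGp : ∀ {S : Set (Fin (n + 1) → ℝ)}, S ⊆ {z | Fin.init z ∈ piece.domain} →
      ContinuousOn (fun y : Fin (n + 1) → ℝ => g (Fin.init y) + (ε:ℝ)) S :=
    fun hSs => hgpc.comp continuous_init'.continuousOn fun z hz => hSs hz
  have coGm : ∀ {S : Set (Fin (n + 1) → ℝ)}, S ⊆ {z | Fin.init z ∈ piece.domain} →
      ContinuousOn (fun y : Fin (n + 1) → ℝ => g (Fin.init y) - (ε:ℝ)) S :=
    fun hSs => hgmc.comp continuous_init'.continuousOn fun z hz => hSs hz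
  have coK : ∀ {S : Set (Fin (n + 1) → ℝ)} (r : ℝ), ContinuousOn (fun _ : Fin (n + 1) → ℝ => r) S :=
    fun r => continuousOn_const
  have saΦ : ∀ {S : Set (Fin (n + 1) → ℝ)}, IsSemialgebraic ℚ S → S ⊆ {z | Fin.init z ∈ piece.domain} →
      IsSemialgebraicFunOn ℚ S (fun y => piece.integrand (Fin.init y)) :=
    fun hS hSs => piece.isSemialgebraicFunOn_integrand.comp_init_mono hS hSs
  have coΦ : ∀ {S : Set (Fin (n + 1) → ℝ)}, S ⊆ {z | Fin.init z ∈ piece.domain} →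
      ContinuousOn (fun y : Fin (n + 1) → ℝ => piece.integrand (Fin.init y)) S :=
    fun hSs => hφc.comp continuous_init'.continuousOn fun z hz => hSs hz
  -- the weighted residue form `ω = c/(w - y) + Nr/Dr`, `c = A(x,y)/B(x,y)`
  obtain ⟨Nr, Dr, Qd, rf1, rf2, rf3, rf4⟩ := ReIm.exists_residueFormE F A B
  -- `B·F ≠ 0` on the closed square strip off the root, `Dr ≠ 0` on the whole closed square (at graph points)
  have hFsq : ∀ x ∈ piece.domain, ∀ s v : ℝ, g x - ε ≤ s → s ≤ g x + ε → 0 ≤ v → v ≤ ε → ¬ (s = g x ∧ v = 0) →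
      aeval (ReIm.cplxPoint (Fin.snoc (Fin.snoc x s : Fin (n + 1) → ℝ) v)) (B * F) ≠ 0 := by
    intro x hx s v h1 h2 h3 h4 hne
    have hm := hmarg x hx
    exact aeval_cplxPoint_ne_zero_of_isolated hiso hx (by linarith [hm.1]) (by linarith [hm.2])
      (by rw [abs_of_nonneg h3]; exact h4.trans hεc.le) hne
  have hDr_pt : ∀ x ∈ piece.domain, ∀ s v : ℝ, g x - ε ≤ s → s ≤ g x + ε → 0 ≤ v → v ≤ ε →
      aeval (ReIm.cplxPoint (Fin.snoc (Fin.snoc (Fin.snoc x (g x) : Fin (n + 1) → ℝ) s : Fin (n + 2) → ℝ) v)) Dr ≠ 0 := by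
    intro x hx s v h1 h2 h3 h4
    by_cases hsv : s = g x ∧ v = 0
    · obtain ⟨hs, hv⟩ := hsv
      subst hs hv
      rw [ReIm.cplxPoint_snoc_zero, RootIso.aeval_ofReal_comp, Complex.ofReal_ne_zero, rf4 x (g x) (g x), rf2 x (g x)]
      exact mul_ne_zero (mul_ne_zero (hB x hx) (hB x hx)) (hFz x hx)
    · exact (ReIm.ratRe_ratIm_eqE rf1 rf3 rf4 x (g x) (piece.integrand x) s v (hF x hx) (hB x hx) (hcB x hx) hsv
        (hFsq x hx s v h1 h2 h3 h4 hsv)).1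
  -- the closed inner square (as a band over the band `T`)
  let SqS : Set (Fin (n + 2) → ℝ) :=
    KZlog.band (KZlog.band piece.domain (fun x => g x - ε) (fun x => g x + ε))
      (fun y => (fun _ : Fin n → ℝ => (0:ℝ)) (Fin.init y)) (fun y => (fun _ : Fin n → ℝ => (ε:ℝ)) (Fin.init y))
  have hSq : IsSemialgebraic ℚ SqS :=
    KZlog.isSemialgebraic_band ((isSemialgebraicFunOn_ratCast hT 0).congr (fun _ _ => by simp))
      ((isSemialgebraicFunOn_ratCast hT ε).congr (fun _ _ => rfl))
  have hSqc : IsCompact SqS := isCompact_band hTc continuousOn_const continuousOn_const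
  have hsτ : SqS ⊆ {w | Fin.init (Fin.init w) ∈ piece.domain} := fun w hw => hw.1.1
  have hDr : ∀ w ∈ SqS, aeval (ReIm.cplxPoint (ReIm.gpt g w)) Dr ≠ 0 := by
    intro w hw
    obtain ⟨hx, ⟨h1, h2⟩, ⟨h3, h4⟩⟩ := (mem_band_band_iff w).1 hw
    rw [eq_snoc_snoc w, ReIm.gpt_snoc_snoc]
    exact hDr_pt _ hx _ _ h1 h2 h3 h4
  have hDden : ∀ w ∈ SqS, aeval (ReIm.cplxPoint (ReIm.gpt g w)) (ReIm.dDen Dr) ≠ 0 := by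
    intro w hw
    simp only [ReIm.dDen, map_mul]
    exact mul_ne_zero (hDr w hw) (hDr w hw)
  have hgcc : ContinuousOn (fun w : Fin (n + 2) → ℝ => g (Fin.init (Fin.init w))) SqS :=
    hgc.comp (continuous_init'.comp continuous_init').continuousOn fun w hw => hsτ hw
  -- edge points lie in the square
  have memT : ∀ y ∈ KZlog.band piece.domain (fun x => g x - ε) (fun x => g x + ε),
      (Fin.snoc y (ε:ℝ) : Fin (n + 2) → ℝ) ∈ SqS :=
    fun y hy => KZlog.snoc_mem_band.2 ⟨hy, hε.le, le_rfl⟩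
  have memB : ∀ y ∈ KZlog.band piece.domain (fun x => g x - ε) (fun x => g x + ε),
      (Fin.snoc y (0:ℝ) : Fin (n + 2) → ℝ) ∈ SqS :=
    fun y hy => KZlog.snoc_mem_band.2 ⟨hy, le_rfl, hε.le⟩
  have memR : ∀ y ∈ KZlog.band piece.domain (fun _ => (0:ℝ)) (fun _ => (ε:ℝ)),
      (Fin.snoc (Fin.snoc (Fin.init y) (g (Fin.init y) + (ε:ℝ)) : Fin (n + 1) → ℝ) (y (Fin.last n)) : Fin (n + 2) → ℝ)
        ∈ SqS := by
    rintro y ⟨hx, h1, h2⟩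
    refine KZlog.snoc_mem_band.2 ⟨KZlog.snoc_mem_band.2 ⟨hx, ?_, le_rfl⟩, ?_⟩
    · show g (Fin.init y) - ε ≤ g (Fin.init y) + ε; linarith
    · simpa using And.intro h1 h2
  have memL : ∀ y ∈ KZlog.band piece.domain (fun _ => (0:ℝ)) (fun _ => (ε:ℝ)),
      (Fin.snoc (Fin.snoc (Fin.init y) (g (Fin.init y) - (ε:ℝ)) : Fin (n + 1) → ℝ) (y (Fin.last n)) : Fin (n + 2) → ℝ)
        ∈ SqS := by
    rintro y ⟨hx, h1, h2⟩
    refine KZlog.snoc_mem_band.2 ⟨KZlog.snoc_mem_band.2 ⟨hx, le_rfl, ?_⟩, ?_⟩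
    · show g (Fin.init y) - ε ≤ g (Fin.init y) + ε; linarith
    · simpa using And.intro h1 h2
  -- semialgebraic / continuous remainder data on the square
  have saRe := ReIm.isSemialgebraicFunOn_ratRe_gpt hgτ Nr Dr hSq hsτ hDr
  have saIm := ReIm.isSemialgebraicFunOn_ratIm_gpt hgτ Nr Dr hSq hsτ hDr
  have coRe := ReIm.continuousOn_ratRe_gpt Nr Dr hgcc hDr
  have coIm := ReIm.continuousOn_ratIm_gpt Nr Dr hgcc hDr
  -- the Green data for the remainder `r = Nr/Dr`
  let rW : IntegralRep (n + 2) := cRep SqS hSq hSqc (fun w => ReIm.ratRe (ReIm.dNum Nr Dr) (ReIm.dDen Dr) (ReIm.gpt g w))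
    (ReIm.isSemialgebraicFunOn_ratRe_gpt hgτ (ReIm.dNum Nr Dr) (ReIm.dDen Dr) hSq hsτ hDden)
    (ReIm.continuousOn_ratRe_gpt (ReIm.dNum Nr Dr) (ReIm.dDen Dr) hgcc hDden)
  have hrWd : rW.domain = SqS := rfl
  let bPr : IntegralRep (n + 1) := cRep _ hT hTc
    (fun y => ReIm.ratIm Nr Dr (ReIm.gpt g (Fin.snoc y (ε:ℝ))) - ReIm.ratIm Nr Dr (ReIm.gpt g (Fin.snoc y (0:ℝ))))
    (IsSemialgebraicFunOn.sub_holds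
      (saIm.comp_isSemialgebraicMapOn_holds (isSemialgebraicMapOn_snoc_fun hT (saK hT ε)) (fun y hy => memT y hy))
      (saIm.comp_isSemialgebraicMapOn_holds (isSemialgebraicMapOn_snoc_fun hT (saK0 hT)) (fun y hy => memB y hy)))
    ((coIm.comp (continuousOn_snoc_fun (coK _)) (fun y hy => memT y hy)).sub
      (coIm.comp (continuousOn_snoc_fun (coK _)) (fun y hy => memB y hy)))
  have hbPrd : bPr.domain = KZlog.band piece.domain (fun x => g x - ε) (fun x => g x + ε) := rfl
  let bQr : IntegralRep (n + 1) := cRep _ hV hVc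
    (fun y => ReIm.ratRe Nr Dr (ReIm.gpt g
        (Fin.snoc (Fin.snoc (Fin.init y) (g (Fin.init y) + (ε:ℝ)) : Fin (n + 1) → ℝ) (y (Fin.last n)))) -
      ReIm.ratRe Nr Dr (ReIm.gpt g
        (Fin.snoc (Fin.snoc (Fin.init y) (g (Fin.init y) - (ε:ℝ)) : Fin (n + 1) → ℝ) (y (Fin.last n)))))
    (IsSemialgebraicFunOn.sub_holds
      (saRe.comp_isSemialgebraicMapOn_holds (isSemialgebraicMapOn_snoc_snoc_fun hV (saGp hV (sub0 rfl)))
        (fun y hy => memR y hy))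
      (saRe.comp_isSemialgebraicMapOn_holds (isSemialgebraicMapOn_snoc_snoc_fun hV (saGm hV (sub0 rfl)))
        (fun y hy => memL y hy)))
    ((coRe.comp (continuousOn_snoc_snoc_fun (coGp (sub0 rfl))) (fun y hy => memR y hy)).sub
      (coRe.comp (continuousOn_snoc_snoc_fun (coGm (sub0 rfl))) (fun y hy => memL y hy)))
  have hbQrd : bQr.domain = KZlog.band piece.domain (fun _ => (0:ℝ)) (fun _ => (ε:ℝ)) := rfl
  have gr : of bQr - of bPr ∈ relations :=
    ReIm.of_sub_of_mem_relations_green_rat_gpt hgτ Nr Dr hgm hgp hK0 hKε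
      (fun x hx => by linarith) (fun _ _ => hε.le) rW bPr bQr hrWd hDr (fun _ _ => rfl)
      hbPrd (fun _ _ => rfl) hbQrd (fun _ _ => rfl)
  -- the output representations `E1` (inner vertical edges), `E2` (inner top edge)
  have hD_E1p : ∀ y ∈ KZlog.band piece.domain (fun _ => (0:ℝ)) (fun _ => (ε:ℝ)), aeval (ReIm.cplxPoint
      (Fin.snoc (Fin.snoc (Fin.init y) (g (Fin.init y) + (ε:ℝ)) : Fin (n + 1) → ℝ) (y (Fin.last n)) : Fin (n + 2) → ℝ)) (B * F) ≠ 0 := by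
    rintro y ⟨hx, h1, h2⟩
    exact hFsq _ hx _ _ (by linarith) le_rfl h1 h2 (by rintro ⟨h0, -⟩; linarith)
  have hD_E1m : ∀ y ∈ KZlog.band piece.domain (fun _ => (0:ℝ)) (fun _ => (ε:ℝ)), aeval (ReIm.cplxPoint
      (Fin.snoc (Fin.snoc (Fin.init y) (g (Fin.init y) - (ε:ℝ)) : Fin (n + 1) → ℝ) (y (Fin.last n)) : Fin (n + 2) → ℝ)) (B * F) ≠ 0 := by
    rintro y ⟨hx, h1, h2⟩
    exact hFsq _ hx _ _ le_rfl (by linarith) h1 h2 (by rintro ⟨h0, -⟩; linarith)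
  have hD_E2 : ∀ y ∈ KZlog.band piece.domain (fun x => g x - ε) (fun x => g x + ε),
      aeval (ReIm.cplxPoint (Fin.snoc y (ε:ℝ) : Fin (n + 2) → ℝ)) (B * F) ≠ 0 := by
    rintro y ⟨hx, h1, h2⟩
    rw [← Fin.snoc_init_self y]
    exact hFsq _ hx _ _ h1 h2 hε.le le_rfl (by rintro ⟨-, h0⟩; exact hε.ne' h0)
  let E1 : IntegralRep (n + 1) := cRep _ hV hVc
    (fun y => ReIm.ratRe (A * pderiv (Fin.last n) F) (B * F)
        (Fin.snoc (Fin.snoc (Fin.init y) (g (Fin.init y) + (ε:ℝ)) : Fin (n + 1) → ℝ) (y (Fin.last n))) -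
      ReIm.ratRe (A * pderiv (Fin.last n) F) (B * F)
        (Fin.snoc (Fin.snoc (Fin.init y) (g (Fin.init y) - (ε:ℝ)) : Fin (n + 1) → ℝ) (y (Fin.last n))))
    (IsSemialgebraicFunOn.sub_holds (sa_Re _ (B * F) hV (saGp hV (sub0 rfl)) hD_E1p) (sa_Re _ (B * F) hV (saGm hV (sub0 rfl)) hD_E1m))
    ((co_Re _ (B * F) (coGp (sub0 rfl)) hD_E1p).sub (co_Re _ (B * F) (coGm (sub0 rfl)) hD_E1m))
  have hE1d : E1.domain = KZlog.band piece.domain (fun _ => (0:ℝ)) (fun _ => (ε:ℝ)) := rfl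
  let E2 : IntegralRep (n + 1) := cRep _ hT hTc (fun y => ReIm.ratIm (A * pderiv (Fin.last n) F) (B * F) (Fin.snoc y (ε:ℝ)))
    (sa_Im _ (B * F) hT (saK hT ε) hD_E2) (co_Im _ (B * F) (coK _) hD_E2)
  have hE2d : E2.domain = KZlog.band piece.domain (fun x => g x - ε) (fun x => g x + ε) := rfl
  -- the pole representations `P₁`, `P₂` (weight `φ = piece.integrand`)
  have hP1sa : IsSemialgebraicFunOn ℚ (KZlog.band piece.domain (fun _ => (0:ℝ)) (fun _ => (ε:ℝ)))
      (fun z => 2 * piece.integrand (Fin.init z) * (ε:ℝ) / ((ε:ℝ) ^ 2 + z (Fin.last n) ^ 2)) := by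
    refine (IsSemialgebraicFunOn.mul_holds (saΦ hV (sub0 rfl))
      (isSemialgebraicFunOn_aeval_div_aeval hV (C (2:ℚ) * C ε) (C ε ^ 2 + X (Fin.last n) ^ 2)
        fun z _ => ?_)).congr fun z _ => ?_
    · simp only [map_add, map_pow, MvPolynomial.aeval_X, MvPolynomial.aeval_C, eq_ratCast]; positivity
    · simp only [Pi.mul_apply, map_add, map_mul, map_pow, MvPolynomial.aeval_X, MvPolynomial.aeval_C, eq_ratCast,
        Rat.cast_ofNat]
      ring
  have hP1c : ContinuousOn
      (fun z : Fin (n + 1) → ℝ => 2 * piece.integrand (Fin.init z) * (ε:ℝ) / ((ε:ℝ) ^ 2 + z (Fin.last n) ^ 2))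
      (KZlog.band piece.domain (fun _ => (0:ℝ)) (fun _ => (ε:ℝ))) :=
    ((continuousOn_const.mul (coΦ (sub0 rfl))).mul continuousOn_const).div
      (continuousOn_const.add (((continuous_apply _).continuousOn).pow 2)) fun z _ => by positivity
  let P₁ : IntegralRep (n + 1) := cRep _ hV hVc
    (fun z => 2 * piece.integrand (Fin.init z) * (ε:ℝ) / ((ε:ℝ) ^ 2 + z (Fin.last n) ^ 2)) hP1sa hP1c
  have hP1d : P₁.domain = KZlog.band piece.domain (fun _ => (0:ℝ)) (fun _ => (ε:ℝ)) := rfl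
  have hQ2 : ∀ z ∈ KZlog.band piece.domain (fun x => g x - ε) (fun x => g x + ε),
      aeval (Fin.snoc z (g (Fin.init z)) : Fin (n + 2) → ℝ)
        ((X (Fin.castSucc (Fin.last n)) - X (Fin.last (n + 1))) ^ 2 + C ε ^ 2 : MvPolynomial (Fin (n + 2)) ℚ) ≠ 0 := by
    intro z _
    simp only [map_add, map_sub, map_pow, MvPolynomial.aeval_X, MvPolynomial.aeval_C, eq_ratCast, Fin.snoc_castSucc,
      Fin.snoc_last]
    positivity
  have hP2sa : IsSemialgebraicFunOn ℚ (KZlog.band piece.domain (fun x => g x - ε) (fun x => g x + ε))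
      (fun z => piece.integrand (Fin.init z) * (ε:ℝ) / ((z (Fin.last n) - g (Fin.init z)) ^ 2 + (ε:ℝ) ^ 2)) := by
    refine (IsSemialgebraicFunOn.mul_holds (saΦ hT (sub0 rfl))
      (sa_polyQuot_graph hT (saG hT (sub0 rfl)) (C ε)
        ((X (Fin.castSucc (Fin.last n)) - X (Fin.last (n + 1))) ^ 2 + C ε ^ 2) hQ2)).congr fun z _ => ?_
    simp only [Pi.mul_apply, map_add, map_sub, map_pow, MvPolynomial.aeval_X, MvPolynomial.aeval_C,
      eq_ratCast, Fin.snoc_last, Fin.snoc_castSucc]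
    ring
  have hP2c : ContinuousOn
      (fun z : Fin (n + 1) → ℝ => piece.integrand (Fin.init z) * (ε:ℝ) / ((z (Fin.last n) - g (Fin.init z)) ^ 2 + (ε:ℝ) ^ 2))
      (KZlog.band piece.domain (fun x => g x - ε) (fun x => g x + ε)) :=
    ((coΦ (sub0 rfl)).mul continuousOn_const).div
      (((((continuous_apply _).continuousOn).sub (coG (sub0 rfl))).pow 2).add continuousOn_const)
      fun z _ => by positivity
  let P₂ : IntegralRep (n + 1) := cRep _ hT hTc
    (fun z => piece.integrand (Fin.init z) * (ε:ℝ) / ((z (Fin.last n) - g (Fin.init z)) ^ 2 + (ε:ℝ) ^ 2)) hP2sa hP2c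
  have hP2d : P₂.domain = KZlog.band piece.domain (fun x => g x - ε) (fun x => g x + ε) := rfl
  -- rA: `E1 = P₁ + bQr` (residue form on the two vertical edges)
  have rA : of E1 - of P₁ - of bQr ∈ relations := by
    refine rel_add E1 P₁ bQr (hP1d.trans hE1d.symm) (hbQrd.trans hE1d.symm) fun z hz => ?_
    obtain ⟨x, v, rfl⟩ : ∃ (x : Fin n → ℝ) (v : ℝ), z = Fin.snoc x v :=
      ⟨Fin.init z, z (Fin.last n), (Fin.snoc_init_self z).symm⟩
    have hz' : (Fin.snoc x v : Fin (n + 1) → ℝ) ∈ KZlog.band piece.domain (fun _ => (0:ℝ)) (fun _ => (ε:ℝ)) := hz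
    obtain ⟨hx, hv0, hvε⟩ := KZlog.snoc_mem_band.1 hz'
    have hRp := (ReIm.ratRe_ratIm_eqE rf1 rf3 rf4 x (g x) (piece.integrand x) (g x + (ε:ℝ)) v (hF x hx) (hB x hx) (hcB x hx)
      (by rintro ⟨h0, -⟩; linarith)
      (hFsq x hx _ _ (by linarith) le_rfl hv0 hvε (by rintro ⟨h0, -⟩; linarith))).2.1
    have hRm := (ReIm.ratRe_ratIm_eqE rf1 rf3 rf4 x (g x) (piece.integrand x) (g x - (ε:ℝ)) v (hF x hx) (hB x hx) (hcB x hx)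
      (by rintro ⟨h0, -⟩; linarith)
      (hFsq x hx _ _ le_rfl (by linarith) hv0 hvε (by rintro ⟨h0, -⟩; linarith))).2.1
    show _ - _ = _ / _ + (_ - _)
    simp only [Fin.init_snoc, Fin.snoc_last, ReIm.gpt_snoc_snoc]
    rw [hRp, hRm]
    have e1 : g x + (ε:ℝ) - g x = ε := by ring
    have e2 : g x - (ε:ℝ) - g x = -ε := by ring
    rw [e1, e2]
    ring
  -- rB: `bPr = E2 + P₂` (residue form on the top edge; the bottom edge carries `Im r = 0`)
  have rB : of bPr - of E2 - of P₂ ∈ relations := by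
    refine rel_add bPr E2 P₂ (hE2d.trans hbPrd.symm) (hP2d.trans hbPrd.symm) fun z hz => ?_
    obtain ⟨x, u, rfl⟩ : ∃ (x : Fin n → ℝ) (u : ℝ), z = Fin.snoc x u :=
      ⟨Fin.init z, z (Fin.last n), (Fin.snoc_init_self z).symm⟩
    have hz' : (Fin.snoc x u : Fin (n + 1) → ℝ) ∈ KZlog.band piece.domain (fun x => g x - ε) (fun x => g x + ε) := hz
    obtain ⟨hx, hu1, hu2⟩ := KZlog.snoc_mem_band.1 hz'
    have hIm := (ReIm.ratRe_ratIm_eqE rf1 rf3 rf4 x (g x) (piece.integrand x) u (ε:ℝ) (hF x hx) (hB x hx) (hcB x hx)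
      (by rintro ⟨-, h0⟩; exact hε.ne' h0)
      (hFsq x hx _ _ hu1 hu2 hε.le le_rfl (by rintro ⟨-, h0⟩; exact hε.ne' h0))).2.2
    show _ - _ = ReIm.ratIm (A * pderiv (Fin.last n) F) (B * F) (Fin.snoc (Fin.snoc x u : Fin (n + 1) → ℝ) (ε:ℝ)) + _ / _
    simp only [Fin.init_snoc, Fin.snoc_last, ReIm.gpt_snoc_snoc, ReIm.ratIm_snoc_zero, sub_zero]
    rw [hIm]
    ring
  -- assemble
  refine ⟨P₁, P₂, E1, E2, hP1d, fun _ _ => rfl, hP2d, fun _ _ => rfl, ⟨hE1d, fun _ _ => rfl⟩, ⟨hE2d, fun _ _ => rfl⟩, ?_⟩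
  have key : of E1 - of E2 - (of P₁ + of P₂) =
      (of E1 - of P₁ - of bQr) + (of bQr - of bPr) + (of bPr - of E2 - of P₂) := by abel
  rw [key]
  exact add_mem (add_mem rA gr) rB

/-- **GLUE-E (kernel-checked): `OuterGreenE → InnerResidueE → OuterInSectorE → GreenReductionE`** (with
`N := A·F_w`, `D := B·F` in the generic statements). -/
theorem greenReductionE_of (h1 : OuterGreenE) (h2 : InnerResidueE) (h3 : OuterInSectorE) : GreenReductionE := by
  intro n g U piece F A B lo hi a b c ε hU hsub hg han hlohi hdom hF hFz hB hint hiso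
  obtain ⟨E1, E2, BQ, BP, hE1, hE2, hBQ, hBP, hBrel⟩ :=
    h1 n g U piece (A * pderiv (Fin.last n) F) (B * F) lo hi a b c ε hU hsub hg han hlohi hdom hiso
  obtain ⟨P₁, P₂, E1', E2', hP₁d, hP₁i, hP₂d, hP₂i, hE1', hE2', hA⟩ :=
    h2 n g U piece F A B lo hi a b c ε hU hsub hg han hlohi hdom hF hFz hB hint hiso
  obtain ⟨hQ, hP⟩ := h3 n g U piece (A * pderiv (Fin.last n) F) (B * F) lo hi a b c ε hU hsub hg han hlohi hdom
    hiso BQ BP hBQ hBP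
  have hC1 : of E1 - of E1' ∈ relations := of_sub_of_eq_spec hE1.1 hE1.2 hE1'.1 hE1'.2
  have hC2 : of E2 - of E2' ∈ relations := of_sub_of_eq_spec hE2.1 hE2.2 hE2'.1 hE2'.2
  have hrel : -(of E1' - of E2' - (of P₁ + of P₂)) - (of E1 - of E1') + (of E2 - of E2') +
      (of E1 - of E2 - (of BQ - of BP)) ∈ relations :=
    add_mem (add_mem (sub_mem (neg_mem hA) hC1) hC2) hBrel
  have hsec : of BQ - of BP ∈ AddSubgroup.closure RatBoxSet :=
    sub_mem (AddSubgroup.subset_closure hQ) (AddSubgroup.subset_closure hP)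
  refine ⟨P₁, P₂, hP₁d, hP₁i, hP₂d, hP₂i, ?_⟩
  have : of P₁ + of P₂ = (-(of E1' - of E2' - (of P₁ + of P₂)) - (of E1 - of E1') + (of E2 - of E2') +
      (of E1 - of E2 - (of BQ - of BP))) + (of BQ - of BP) := by abel
  rw [this]
  exact add_mem (AddSubgroup.mem_sup_left hrel) (AddSubgroup.mem_sup_right hsec)

/-- **`GreenReductionE` HOLDS.** -/
theorem greenReductionE_holds : GreenReductionE :=
  greenReductionE_of outerGreenE_holds innerResidueE_holds outerInSectorE_holds

end Summit.KontsevichZagierPeriods.RootDecompRationalCubeDichotomy.RungEtale.Etale
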